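import Literature.AnabelianGeometry.EtaleTheta.Discharge.Sec5KummerRootEquivariance
import Literature.AnabelianGeometry.EtaleTheta.Discharge.Sec5Prop55EtaTautological
import Literature.AnabelianGeometry.EtaleTheta.Discharge.Sec5OfConnectedTemperoid

/-!
# [EtTh] Prop. 5.2 (iii) ONE input, not two: F-0521 `ThetaSectionCompat` (abc-iut-L2-t11) ⟺ the `(η, ν)`-pin
# `ThetaPairKummerClass` (abc-iut-L2-t4) — the `TODO-merge(t2/t4 ↔ t11)` bridge, and G-L6t23-3 `hKR` from the pin at the
# assembled §5 data and at the GENUINE connected data `ofConnectedTemperoidData` (pp. 324, 327–328, 331 / PDF pp. 98, 101–102, 105)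

Mochizuki, *The étale theta function and its Frobenioid-theoretic manifestations*, Publ. RIMS **45** (2009)
[cite: MochizukiEtTh2009, Prop 5.2 (iii) p.324 (PDF p.98); Prop 5.5 proof p.327–328 (PDF pp.101–102); §2 p.272–273 (PDF pp.46–47)].
Layer L2 of the abc-iut cell, seat abc-iut-w4-d099 (gen 4); abc-iut-L2-lead ROWS #13-addendum R157 «base-side producers for
`hcup_of_dictionary` / `hKR_ofBiKummerData_of_dictionary` at abc-iut-L2-t4's `ofConnectedTemperoidData`».  PROOF-ONLY (no definition,
no named fact; nothing landed is edited).

The two typings of [EtTh] Prop. 5.2 (iii) («the Kummer class determined by the bi-Kummer `N`-th root … corresponds precisely to the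
reduction modulo `N` of the class `η̲̈^Θ` … relative to the natural isomorphism between `μ_N(−)` and `(l·Δ_Θ) ⊗ ℤ/Nℤ`», p.324) in the
tree are
* abc-iut-L2-t4's cocycle form `FrobenioidThetaBiKummer.ThetaPairKummerClass 𝔉 η ν` (`FrobenioidThetaBiKummer.lean`): the PRINT-oriented
  difference `s^⊓-gp_N(h) · s^⊔-gp_N(h)⁻¹` on `H_{B_N}` equals `ν (η h)` up to the `μ_N(B_N)`-coboundary of some `u ∈ μ_N(B_N)`, where
  in every consumer (`cyclotomicRigidity_ofBiKummerData_of_laws`, …, this lineage's p427547) `η` is PINNED to a §2 theta cocycle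
  `η₀ ∈ RD.thetaCocycles` descended along `ρ` (abc-iut-w5-d123's `ThetaEnvData.exists_descent_thetaCocycle`, binders `hη₀ hdies e hK`);
* abc-iut-L2-t11's value form `ThetaFrobenioid.ThetaSectionCompat H RD ι m hYdd η₁` (`Discharge/Sec5EnvelopeTopology.lean`, FACT-LIST
  row F-0521, «named hypothesis; to be derived from abc-iut-L2-t4's `ThetaPairKummerClass` once the two interfaces are merged»): the
  INVERSE difference `s^⊔-gp_N(ρ h) · s^⊓-gp_N(ρ h)⁻¹`, read through `m : μ_N(B_N) ≃ μ_N`, IS `η₁⁻¹` on the nose.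
THIS FILE does the merge, generically over any `𝔉 : ThetaFrobenioid C D` against any §2 `RD : RigidData 𝔉.N l′`:
* `m_diffCocycle_eq_of_kummerClass` — the pointwise computation: if the print difference is `[s^⊓-gp_N(h), u] · ν(η h)`, then through
  `m` the inverse difference at `h = ρ k` is `(m ν η (ρ k))⁻¹ · ∂(m u)(ι k)`, `∂c = (g ↦ c · (χ(aug g) c)⁻¹)` the §2 coboundary
  (`CycEnvelope.coboundary`) — the conjugation `s^⊓-gp_N(ρ k) u⁻¹ s^⊓-gp_N(ρ k)⁻¹` being `χ(aug(ι k))(m u)⁻¹` by abc-iut-L2-t11's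
  `CyclotomicCharacterCompatX` (Lemma 5.8: `G_K` acts on `μ_N(B_N)` through the cyclotomic character);
* **`exists_thetaSectionCompat_of_thetaPairKummerClass`** — F-0521 HOLDS for the theta cocycle `η₁ := η₀ · ∂(m u)⁻¹`, which lies in
  `RD.thetaCocycles` because the §2 collection «consists of full cohomology classes» (abc-iut-L2-t2's field `mul_coboundary_mem`, p.47:
  «the various `s^Θ_Ÿ` that arise from different choices of [a cocycle] … are `Π^tp_X[μ_N]`-conjugates»); and the converse
  **`thetaPairKummerClass_of_thetaSectionCompat`** (`u := 1`).  So F-0521 and the `(η, ν)`-pin are ONE input of the §5 discharge chain.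
* At abc-iut-L2-t4's assembled data `ofBiKummerData` (`ι = id`, `Π^tp_Ÿ̲ = Π^tp_Ÿ` definitionally): **`hKR_ofBiKummerData_of_thetaPairKummerClass`**
  and **`hKR_ofBiKummerData_of_pin`** — abc-iut-L2-t11's `hKR_ofBiKummerData_of_dictionary` (GAP row G-L6t23-3's wanted declaration) with
  its binders `hYdd` DISCHARGED (`Iff.rfl`) and `hη`/`hcompat` PRODUCED from the pin binders `hη₀ hdies e hK` of the Prop. 5.5 chain
  (the same terms abc-iut-w5-d020's `cyclotomicRigidity_ofBiKummerData_of_laws` and this lineage's p427547 already take) plus ONE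
  normalisation `hme : m ∘ ν ∘ e = id` tying abc-iut-L2-t11's `m` to abc-iut-L2-t4's `(e, ν)`;
* at the GENUINE connected data `ofConnectedTemperoidData` over `B^temp(Π^tp_X)⁰` (abc-iut-L2-t4, `Discharge/Sec5OfConnectedTemperoid.lean`):
  **`hKR_ofConnectedTemperoidData_of_pin`** — additionally `hσ := baseMap_strvOfBiKummerData`, `hfrac := coe_fracOfModel_mul_unit`
  DISCHARGED (abc-iut-L2-t4 INFO-1 on p427547), so the residual inputs of `hKR` there are exactly: the pin `{hη₀, hdies, e, hme, hK}`,
  `H : Facts` (⟸ `{hH, hconst, hgc}`, `facts_ofConnectedTemperoidData`), the cyclotome dictionary `m` with `CyclotomicCharacterCompatX`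
  (⟸ the Galois dictionary of the constants, abc-iut-L2-t11's `cyclotomicCharacterCompatX_of_galoisDictionary`), and the coverage `hcov`
  of the `(l·Δ_Θ)`-part of `H_{B_N}` (GAP G-w5d123-2 family; abc-iut-w4-d042's `hlift` shapes at the Aut-projection).
HONEST FRAMING: kernel-checked implications between typed statements; the pin, the dictionary and the coverage remain hypotheses to be
instantiated; nothing of [EtTh] is asserted unconditionally; typed ≠ proved; no side is taken on anything downstream ([IUTchIII] Cor. 3.12).
-/

noncomputable section

namespace Literature.AnabelianGeometry.EtaleTheta

open CategoryTheory Opposite Literature.AlgebraicGeometry.Frobenioids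

universe w v v' u u'

namespace ThetaFrobenioid

/-! ### Generic: F-0521 `ThetaSectionCompat` ⟺ the `(η, ν)`-pin `ThetaPairKummerClass` -/

section Generic

variable {C : Type u} [Category.{v} C] {D : Type u'} [Category.{v'} D] (𝔉 : ThetaFrobenioid.{w} C D)
  {l' : ℕ} (RD : RigidData.{v} 𝔉.N l') (H : 𝔉.Facts) (ι : 𝔉.PiX ≃* RD.PiX)
  (m : 𝔉.muTorsion 𝔉.BN 𝔉.N ≃* RD.mu) (hYdd : 𝔉.IdentifiesPiYdd RD.toThetaEnvData ι)

/-- **The pointwise computation.**  If the print-oriented bi-Kummer difference satisfies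
`s^⊓-gp_N(h) · s^⊔-gp_N(h)⁻¹ = [s^⊓-gp_N(h), u] · ν(η h)` on `H_{B_N}` for some `u ∈ μ_N(B_N)` (the body of abc-iut-L2-t4's
`ThetaPairKummerClass`), then for every `k ∈ Π^tp_Ÿ̲` the inverse difference `d(k) = s^⊔-gp_N(ρ k) · s^⊓-gp_N(ρ k)⁻¹` read through `m` is
`(m ν η (ρ k))⁻¹ · ∂(m u)(ι k)` with `∂c(g) = c · (χ(aug g) c)⁻¹` — the conjugate `s^⊓-gp_N(ρ k) u⁻¹ s^⊓-gp_N(ρ k)⁻¹` being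
`χ(aug(ι k)) (m u)⁻¹` by `CyclotomicCharacterCompatX` (Lemma 5.8).
[cite: MochizukiEtTh2009, Prop 5.2 (iii) p.324 (PDF p.98); Lem 5.8 proof p.331 (PDF p.105)] -/
theorem m_diffCocycle_eq_of_kummerClass (hχX : 𝔉.CyclotomicCharacterCompatX RD.toThetaEnvData ι m)
    (ν : 𝔉.lDeltaModN 𝔉.BN ≃* 𝔉.muTorsion 𝔉.BN 𝔉.N) (η : 𝔉.HB → 𝔉.lDeltaModN 𝔉.BN)
    {u : Aut 𝔉.BN} (hu : u ∈ 𝔉.muTorsion 𝔉.BN 𝔉.N)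
    (hKC : ∀ h : 𝔉.HB, 𝔉.sgpCap (h : Aut (𝔉.base.obj 𝔉.BN)) * (𝔉.sgpCup h)⁻¹ =
      (𝔉.sgpCap (h : Aut (𝔉.base.obj 𝔉.BN)) * u * (𝔉.sgpCap (h : Aut (𝔉.base.obj 𝔉.BN)))⁻¹ * u⁻¹) *
        (ν (η h) : Aut 𝔉.BN))
    (k : 𝔉.PiYdd) :
    m (𝔉.diffCocycle H k) = (m (ν (η (𝔉.rhoYdd k))))⁻¹ *
      CycEnvelope.coboundary (RD.aug.comp RD.PiYdd.subtype) RD.chi (m ⟨u, hu⟩) ⟨ι k, (hYdd k).mp k.2⟩ := by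
  set a : Aut 𝔉.BN := 𝔉.sgpCap (𝔉.ρ k) with ha
  have hw : a * u⁻¹ * a⁻¹ ∈ 𝔉.muTorsion 𝔉.BN 𝔉.N := (𝔉.muTorsion_normal _ _).conj_mem _ (inv_mem hu) a
  -- Lemma 5.8 through `m`: the conjugate of `u⁻¹` is `χ(aug(ι k)) (m u)⁻¹`
  have h1 : m ⟨a * u⁻¹ * a⁻¹, hw⟩ = RD.chi (RD.aug (ι k)) (m ⟨u, hu⟩)⁻¹ := by
    have e1 : (m ⟨u, hu⟩)⁻¹ = m ⟨u, hu⟩⁻¹ := (map_inv m _).symm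
    rw [e1]
    exact hχX k ⟨u, hu⟩⁻¹ ⟨a * u⁻¹ * a⁻¹, hw⟩ rfl
  -- the inverse difference as a product of three elements of `μ_N(B_N)`
  have h2 : 𝔉.diffCocycle H k = (ν (η (𝔉.rhoYdd k)))⁻¹ * ⟨u, hu⟩ * ⟨a * u⁻¹ * a⁻¹, hw⟩ := by
    apply Subtype.ext
    have hk := hKC (𝔉.rhoYdd k)
    change a * (𝔉.sgpCup (𝔉.rhoYdd k))⁻¹ = a * u * a⁻¹ * u⁻¹ * _ at hk
    change 𝔉.sgpCup (𝔉.rhoYdd k) * a⁻¹ = ((ν (η (𝔉.rhoYdd k)) : Aut 𝔉.BN))⁻¹ * u * (a * u⁻¹ * a⁻¹)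
    calc 𝔉.sgpCup (𝔉.rhoYdd k) * a⁻¹ = (a * (𝔉.sgpCup (𝔉.rhoYdd k))⁻¹)⁻¹ := by group
      _ = (a * u * a⁻¹ * u⁻¹ * ((ν (η (𝔉.rhoYdd k)) : Aut 𝔉.BN)))⁻¹ := by rw [hk]
      _ = ((ν (η (𝔉.rhoYdd k)) : Aut 𝔉.BN))⁻¹ * u * (a * u⁻¹ * a⁻¹) := by group
  rw [h2, map_mul, map_mul, map_inv, h1]
  simp only [CycEnvelope.coboundary, MonoidHom.coe_comp, Function.comp_apply, Subgroup.coe_subtype, map_inv, mul_assoc]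

/-- **F-0521 `ThetaSectionCompat` FROM abc-iut-L2-t4's `(η, ν)`-pin `ThetaPairKummerClass`** (the `TODO-merge(t2/t4 ↔ t11)` of
`Sec5EnvelopeTopology.lean`): if the print difference equals `ν ∘ η` up to a `μ_N(B_N)`-coboundary (`ThetaPairKummerClass 𝔉 η ν`) and
`η` is pinned through the cyclotome dictionary `m`/`ν` to a §2 theta cocycle `η₀` (`hpin`), then — `G_K` acting on `μ_N(B_N)` through the
cyclotomic character (`CyclotomicCharacterCompatX`, Lemma 5.8) — there is a theta cocycle `η₁ ∈ RD.thetaCocycles` (namely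
`η₀ · ∂(m u)⁻¹`, a member because the §2 collection is closed under coboundaries, `mul_coboundary_mem`, p.273 (PDF p.47)) with
`ThetaSectionCompat H RD ι m hYdd η₁`.  [cite: MochizukiEtTh2009, Prop 5.2 (iii) p.324 (PDF p.98); §2 p.272–273 (PDF pp.46–47)] -/
theorem exists_thetaSectionCompat_of_thetaPairKummerClass (hχX : 𝔉.CyclotomicCharacterCompatX RD.toThetaEnvData ι m)
    {η₀ : RD.PiYdd → RD.mu} (hη₀ : η₀ ∈ RD.thetaCocycles)
    (ν : 𝔉.lDeltaModN 𝔉.BN ≃* 𝔉.muTorsion 𝔉.BN 𝔉.N) (η : 𝔉.HB → 𝔉.lDeltaModN 𝔉.BN)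
    (hpin : ∀ k : 𝔉.PiYdd, m (ν (η (𝔉.rhoYdd k))) = η₀ ⟨ι k, (hYdd k).mp k.2⟩)
    (hKC : FrobenioidThetaBiKummer.ThetaPairKummerClass 𝔉 η ν) :
    ∃ η₁ ∈ RD.thetaCocycles, 𝔉.ThetaSectionCompat H RD.toThetaEnvData ι m hYdd η₁ := by
  obtain ⟨u, hu, hKC⟩ := hKC
  refine ⟨η₀ * CycEnvelope.coboundary (RD.aug.comp RD.PiYdd.subtype) RD.chi (m ⟨u, hu⟩)⁻¹,
    RD.mul_coboundary_mem η₀ hη₀ _, fun k => ?_⟩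
  rw [𝔉.m_diffCocycle_eq_of_kummerClass RD H ι m hYdd hχX ν η hu hKC k, hpin k, Pi.mul_apply]
  simp only [CycEnvelope.coboundary, MonoidHom.coe_comp, Function.comp_apply, Subgroup.coe_subtype, map_inv, mul_inv_rev,
    inv_inv]
  simp only [mul_comm]

/-- **Conversely, abc-iut-L2-t4's `ThetaPairKummerClass` FROM F-0521** (`u := 1`): if `m(d(k)) = η₁(ι k)⁻¹` on `Π^tp_Ÿ̲`
(`ThetaSectionCompat`) and `η : H_{B_N} → (l·Δ_Θ)_{B_N} ⊗ ℤ/Nℤ` is pinned to `η₁` through `m`/`ν`, then the print difference is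
`ν ∘ η` on the nose (trivial coboundary).  [cite: MochizukiEtTh2009, Prop 5.2 (iii) p.324 (PDF p.98)] -/
theorem thetaPairKummerClass_of_thetaSectionCompat {η₁ : RD.PiYdd → RD.mu}
    (hcompat : 𝔉.ThetaSectionCompat H RD.toThetaEnvData ι m hYdd η₁)
    (ν : 𝔉.lDeltaModN 𝔉.BN ≃* 𝔉.muTorsion 𝔉.BN 𝔉.N) (η : 𝔉.HB → 𝔉.lDeltaModN 𝔉.BN)
    (hpin : ∀ k : 𝔉.PiYdd, m (ν (η (𝔉.rhoYdd k))) = η₁ ⟨ι k, (hYdd k).mp k.2⟩) :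
    FrobenioidThetaBiKummer.ThetaPairKummerClass 𝔉 η ν := by
  refine ⟨1, one_mem _, fun h => ?_⟩
  obtain ⟨y, hy, hyh⟩ := Subgroup.mem_map.mp h.2
  have hk : 𝔉.rhoYdd ⟨y, hy⟩ = h := Subtype.ext hyh
  -- through `m`: `d(k) = (ν η h)⁻¹`
  have hd : 𝔉.diffCocycle H ⟨y, hy⟩ = (ν (η h))⁻¹ := by
    apply m.injective
    rw [hcompat ⟨y, hy⟩, map_inv, ← hk, hpin]
  have hd' := congrArg Subtype.val hd
  change 𝔉.sgpCup (𝔉.rhoYdd ⟨y, hy⟩) * (𝔉.sgpCap (𝔉.rhoYdd ⟨y, hy⟩ : Aut (𝔉.base.obj 𝔉.BN)))⁻¹ =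
    ((ν (η h) : Aut 𝔉.BN))⁻¹ at hd'
  rw [hk] at hd'
  rw [mul_one, mul_inv_cancel, inv_one, mul_one, one_mul]
  calc 𝔉.sgpCap (h : Aut (𝔉.base.obj 𝔉.BN)) * (𝔉.sgpCup h)⁻¹
      = (𝔉.sgpCup h * (𝔉.sgpCap (h : Aut (𝔉.base.obj 𝔉.BN)))⁻¹)⁻¹ := by group
    _ = (ν (η h) : Aut 𝔉.BN) := by rw [hd', inv_inv]

end Generic

/-! ### At abc-iut-L2-t4's assembled data `ofBiKummerData`: G-L6t23-3 `hKR` from the `(η, ν)`-pin -/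

section OfBiKummerData

universe u₀ v₀ u₁ v₁ w₁

variable {K : Type u₀} [Field K] {X : SemiGraphs.TemperedArithmeticGroup.{u₀} K} {D₀ : Type u₀} [Category.{v₀} D₀]
  {V : FrdIMonoidStub.{w₁}} {T₀ : RealifiedDivisorMonoids (D₀ := D₀) V} {D : Type u₁} [Category.{v₁} D]
  {VD : FrdICatStub.{u₁, v₁, w₁} D} {S : BiKummerSetting X T₀ D VD}
  {pullFrac : ∀ {A A' : S.C} (_ : A' ⟶ A), S.biratUnits A → S.biratUnits A'}
  {lv N : ℕ+} {l' : ℕ} {RD : RigidData.{max v₁ w₁} N l'} {θ : S.biratUnits S.Aodot} {Bl : S.C}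
  {Pl : S.FractionPair θ Bl} {Rl : S.NthRoot θ Pl lv pullFrac}
  (h : ModelFrobenioid.Hypotheses S.tf.divisorMonoid S.tf.ratFnFunctor)
  (toB : ∀ A : S.C, S.biratUnits A →* S.tf.biratUnitsModel A) (Q : FrobenioidTheta.ThetaSubquotientStub.{w₁} D)
  (odd_l : Odd (lv : ℕ)) (R : S.NthRoot Rl.root Rl.pair N pullFrac) (ιX : RD.PiX ≃ₜ* X.Pi)
  (hopen : IsOpen ((S.galoisSurj R.AN.base R.αData.isGalois).ker : Set X.Pi)) (σ : Aut R.AN.base →* Aut R.AN)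
  (K' : Type w₁) [Field K'] (constEmb : K'ˣ →* S.tf.biratUnitsModel R.BN)
  (constEmb_injective : Function.Injective constEmb)
  (hdivc : ∀ g : Aut R.BN.base,
    ModelFrobenioid.div ((σ ((BiKummerSetting.NthRoot.baseIso S R).conjAut.symm g)).hom ≫ R.pair.num) =
      ModelFrobenioid.div R.pair.num)
  (hdivp : ∀ y : RD.PiYdd,
    ModelFrobenioid.div ((σ (S.galoisSurj R.AN.base R.αData.isGalois (ιX y.1))).hom ≫ R.pair.den) =
      ModelFrobenioid.div R.pair.den)

/-- **G-L6t23-3 (`hKR`) at `ofBiKummerData` FROM THE `(η, ν)`-PIN**: abc-iut-L2-t11's `hKR_ofBiKummerData_of_dictionary` with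
`hYdd` DISCHARGED (`Π^tp_Ÿ̲ = Π^tp_Ÿ` definitionally, `ι = id`) and F-0521 `ThetaSectionCompat` PRODUCED from abc-iut-L2-t4's
`ThetaPairKummerClass` for an `η` pinned to the theta cocycle `η₀` through `m`/`ν` (`exists_thetaSectionCompat_of_thetaPairKummerClass`).
Inputs: `hσ`, `hfrac` ([FrdI] Prop. 5.6 / Thm. 5.2 (ii) laws of the data); `H : Facts`; the cyclotome dictionary `m` with
`CyclotomicCharacterCompatX`; the pin `hη₀`, `hpin`, `hKC`; the coverage `hcov` (GAP G-w5d123-2 family).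
[cite: MochizukiEtTh2009, Prop 5.5 proof p.327–328 (PDF pp.101–102); Prop 5.2 (iii) p.324 (PDF p.98)] -/
theorem hKR_ofBiKummerData_of_thetaPairKummerClass
    (hσ : ∀ g : Aut R.AN.base, ModelFrobenioid.baseMap (σ g).hom = g.hom)
    (hfrac : ∀ {A B : S.C} (s' s'' : A ⟶ B) (h' : S.IsPreStep s') (h'' : S.IsPreStep s'')
      (hb : PreFrobenioid.BaseEquivalent S.F s' s''),
      (toB A (S.fracOf s' s'' h' h'' hb) : S.tf.ratFnFunctor.obj (op A.base)) *
        ModelFrobenioid.unit s'' = ModelFrobenioid.unit s')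
    (P : FrobenioidCyclotomicRigidity.ThetaSubquotientProj
      (ofBiKummerData h toB Q odd_l R ιX hopen σ K' constEmb constEmb_injective hdivc hdivp))
    (H : (ofBiKummerData h toB Q odd_l R ιX hopen σ K' constEmb constEmb_injective hdivc hdivp).Facts)
    (m : (ofBiKummerData h toB Q odd_l R ιX hopen σ K' constEmb constEmb_injective hdivc hdivp).muTorsion
        (ofBiKummerData h toB Q odd_l R ιX hopen σ K' constEmb constEmb_injective hdivc hdivp).BN
        (ofBiKummerData h toB Q odd_l R ιX hopen σ K' constEmb constEmb_injective hdivc hdivp).N ≃* RD.mu)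
    (hχX : (ofBiKummerData h toB Q odd_l R ιX hopen σ K' constEmb constEmb_injective hdivc hdivp).CyclotomicCharacterCompatX
      RD.toThetaEnvData (MulEquiv.refl _) m)
    {η₀ : RD.PiYdd → RD.mu} (hη₀ : η₀ ∈ RD.thetaCocycles)
    (ν : (ofBiKummerData h toB Q odd_l R ιX hopen σ K' constEmb constEmb_injective hdivc hdivp).lDeltaModN
        (ofBiKummerData h toB Q odd_l R ιX hopen σ K' constEmb constEmb_injective hdivc hdivp).BN ≃*
      (ofBiKummerData h toB Q odd_l R ιX hopen σ K' constEmb constEmb_injective hdivc hdivp).muTorsion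
        (ofBiKummerData h toB Q odd_l R ιX hopen σ K' constEmb constEmb_injective hdivc hdivp).BN
        (ofBiKummerData h toB Q odd_l R ιX hopen σ K' constEmb constEmb_injective hdivc hdivp).N)
    (η : (ofBiKummerData h toB Q odd_l R ιX hopen σ K' constEmb constEmb_injective hdivc hdivp).HB →
      (ofBiKummerData h toB Q odd_l R ιX hopen σ K' constEmb constEmb_injective hdivc hdivp).lDeltaModN
        (ofBiKummerData h toB Q odd_l R ιX hopen σ K' constEmb constEmb_injective hdivc hdivp).BN)
    (hpin : ∀ k : RD.PiYdd, m (ν (η ⟨rhoOfBiKummerData R ιX k, Subgroup.mem_map_of_mem _ k.2⟩)) = η₀ k)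
    (hKC : FrobenioidThetaBiKummer.ThetaPairKummerClass
      (ofBiKummerData h toB Q odd_l R ιX hopen σ K' constEmb constEmb_injective hdivc hdivp) η ν)
    (hcov : ∀ k : (ofBiKummerData h toB Q odd_l R ιX hopen σ K' constEmb constEmb_injective hdivc hdivp).HB,
      (k : Aut ((ofBiKummerData h toB Q odd_l R ιX hopen σ K' constEmb constEmb_injective hdivc hdivp).base.obj
        (ofBiKummerData h toB Q odd_l R ιX hopen σ K' constEmb constEmb_injective hdivc hdivp).BN)) ∈ P.pre _ →
      ∃ (y : RD.PiX) (_ : y ∈ RD.PiYdd),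
        (ofBiKummerData h toB Q odd_l R ιX hopen σ K' constEmb constEmb_injective hdivc hdivp).ρ y = k ∧
          y ∈ RD.lDeltaTheta) :
    ∀ (y₀ y : RD.PiX), y ∈ RD.PiYdd → rhoOfBiKummerData R ιX y ∈ P.pre R.BN.base →
      pull S.tf.ratFnFunctor (S.galoisSurj R.AN.base R.αData.isGalois (ιX y)).hom
          (pull S.tf.ratFnFunctor (S.galoisSurj R.AN.base R.αData.isGalois (ιX y₀)).hom
            (toB R.AN R.root : S.tf.ratFnFunctor.obj (op R.AN.base))) *
          (toB R.AN R.root : S.tf.ratFnFunctor.obj (op R.AN.base)) =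
        pull S.tf.ratFnFunctor (S.galoisSurj R.AN.base R.αData.isGalois (ιX y)).hom
            (toB R.AN R.root : S.tf.ratFnFunctor.obj (op R.AN.base)) *
          pull S.tf.ratFnFunctor (S.galoisSurj R.AN.base R.αData.isGalois (ιX y₀)).hom
            (toB R.AN R.root : S.tf.ratFnFunctor.obj (op R.AN.base)) := by
  obtain ⟨η₁, hη₁, hcompat⟩ :=
    (ofBiKummerData h toB Q odd_l R ιX hopen σ K' constEmb constEmb_injective hdivc hdivp)
      |>.exists_thetaSectionCompat_of_thetaPairKummerClass RD H (MulEquiv.refl _) m (fun _ => Iff.rfl) hχX hη₀ ν η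
        (fun k => hpin k) hKC
  exact hKR_ofBiKummerData_of_dictionary h toB Q odd_l R ιX hopen σ K' constEmb constEmb_injective hdivc hdivp hσ hfrac P H
    m (fun _ => Iff.rfl) hη₁ hcompat hχX hcov

/-- **G-L6t23-3 (`hKR`) at `ofBiKummerData` FROM THE PIN BINDERS of the Prop. 5.5 chain** — `hη₀ hdies e hK` VERBATIM as taken by
abc-iut-w5-d020's `cyclotomicRigidity_ofBiKummerData_of_laws` / this lineage's `cyclotomicRigidity_ofBiKummerData_connectedPart_of_pullRoot`
(the descended `η` on `H_{B_N}` exists by abc-iut-w5-d123's `ThetaEnvData.exists_descent_thetaCocycle` under `hdies`), plus ONE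
normalisation `hme : m ∘ ν ∘ e = id` of abc-iut-L2-t11's cyclotome dictionary `m` against abc-iut-L2-t4's `(e, ν)`.
[cite: MochizukiEtTh2009, Prop 5.5 proof p.327–328 (PDF pp.101–102); Prop 5.2 (iii) p.324 (PDF p.98)] -/
theorem hKR_ofBiKummerData_of_pin
    (hσ : ∀ g : Aut R.AN.base, ModelFrobenioid.baseMap (σ g).hom = g.hom)
    (hfrac : ∀ {A B : S.C} (s' s'' : A ⟶ B) (h' : S.IsPreStep s') (h'' : S.IsPreStep s'')
      (hb : PreFrobenioid.BaseEquivalent S.F s' s''),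
      (toB A (S.fracOf s' s'' h' h'' hb) : S.tf.ratFnFunctor.obj (op A.base)) *
        ModelFrobenioid.unit s'' = ModelFrobenioid.unit s')
    (P : FrobenioidCyclotomicRigidity.ThetaSubquotientProj
      (ofBiKummerData h toB Q odd_l R ιX hopen σ K' constEmb constEmb_injective hdivc hdivp))
    (H : (ofBiKummerData h toB Q odd_l R ιX hopen σ K' constEmb constEmb_injective hdivc hdivp).Facts)
    (m : (ofBiKummerData h toB Q odd_l R ιX hopen σ K' constEmb constEmb_injective hdivc hdivp).muTorsion
        (ofBiKummerData h toB Q odd_l R ιX hopen σ K' constEmb constEmb_injective hdivc hdivp).BN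
        (ofBiKummerData h toB Q odd_l R ιX hopen σ K' constEmb constEmb_injective hdivc hdivp).N ≃* RD.mu)
    (hχX : (ofBiKummerData h toB Q odd_l R ιX hopen σ K' constEmb constEmb_injective hdivc hdivp).CyclotomicCharacterCompatX
      RD.toThetaEnvData (MulEquiv.refl _) m)
    {η₀ : RD.PiYdd → RD.mu} (hη₀ : η₀ ∈ RD.thetaCocycles)
    (hdies : ∀ k : RD.PiYdd, rhoOfBiKummerData R ιX k = 1 → η₀ k = 1)
    (e : RD.mu → (ofBiKummerData h toB Q odd_l R ιX hopen σ K' constEmb constEmb_injective hdivc hdivp).lDeltaModN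
      (ofBiKummerData h toB Q odd_l R ιX hopen σ K' constEmb constEmb_injective hdivc hdivp).BN)
    (ν : (ofBiKummerData h toB Q odd_l R ιX hopen σ K' constEmb constEmb_injective hdivc hdivp).lDeltaModN
        (ofBiKummerData h toB Q odd_l R ιX hopen σ K' constEmb constEmb_injective hdivc hdivp).BN ≃*
      (ofBiKummerData h toB Q odd_l R ιX hopen σ K' constEmb constEmb_injective hdivc hdivp).muTorsion
        (ofBiKummerData h toB Q odd_l R ιX hopen σ K' constEmb constEmb_injective hdivc hdivp).BN
        (ofBiKummerData h toB Q odd_l R ιX hopen σ K' constEmb constEmb_injective hdivc hdivp).N)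
    (hme : ∀ x : RD.mu, m (ν (e x)) = x)
    (hK : ∀ η : (ofBiKummerData h toB Q odd_l R ιX hopen σ K' constEmb constEmb_injective hdivc hdivp).HB →
        (ofBiKummerData h toB Q odd_l R ιX hopen σ K' constEmb constEmb_injective hdivc hdivp).lDeltaModN
          (ofBiKummerData h toB Q odd_l R ιX hopen σ K' constEmb constEmb_injective hdivc hdivp).BN,
      (∀ k : RD.PiYdd, η ⟨rhoOfBiKummerData R ιX k, Subgroup.mem_map_of_mem _ k.2⟩ = e (η₀ k)) →
        FrobenioidThetaBiKummer.ThetaPairKummerClass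
          (ofBiKummerData h toB Q odd_l R ιX hopen σ K' constEmb constEmb_injective hdivc hdivp) η ν)
    (hcov : ∀ k : (ofBiKummerData h toB Q odd_l R ιX hopen σ K' constEmb constEmb_injective hdivc hdivp).HB,
      (k : Aut ((ofBiKummerData h toB Q odd_l R ιX hopen σ K' constEmb constEmb_injective hdivc hdivp).base.obj
        (ofBiKummerData h toB Q odd_l R ιX hopen σ K' constEmb constEmb_injective hdivc hdivp).BN)) ∈ P.pre _ →
      ∃ (y : RD.PiX) (_ : y ∈ RD.PiYdd),
        (ofBiKummerData h toB Q odd_l R ιX hopen σ K' constEmb constEmb_injective hdivc hdivp).ρ y = k ∧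
          y ∈ RD.lDeltaTheta) :
    ∀ (y₀ y : RD.PiX), y ∈ RD.PiYdd → rhoOfBiKummerData R ιX y ∈ P.pre R.BN.base →
      pull S.tf.ratFnFunctor (S.galoisSurj R.AN.base R.αData.isGalois (ιX y)).hom
          (pull S.tf.ratFnFunctor (S.galoisSurj R.AN.base R.αData.isGalois (ιX y₀)).hom
            (toB R.AN R.root : S.tf.ratFnFunctor.obj (op R.AN.base))) *
          (toB R.AN R.root : S.tf.ratFnFunctor.obj (op R.AN.base)) =
        pull S.tf.ratFnFunctor (S.galoisSurj R.AN.base R.αData.isGalois (ιX y)).hom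
            (toB R.AN R.root : S.tf.ratFnFunctor.obj (op R.AN.base)) *
          pull S.tf.ratFnFunctor (S.galoisSurj R.AN.base R.αData.isGalois (ιX y₀)).hom
            (toB R.AN R.root : S.tf.ratFnFunctor.obj (op R.AN.base)) := by
  obtain ⟨η, hη⟩ := RD.toThetaEnvData.exists_descent_thetaCocycle (rhoOfBiKummerData R ιX) hη₀ hdies e
  exact hKR_ofBiKummerData_of_thetaPairKummerClass h toB Q odd_l R ιX hopen σ K' constEmb constEmb_injective hdivc hdivp hσ
    hfrac P H m hχX hη₀ ν η (fun k => (congrArg (fun z => m (ν z)) (hη k)).trans (hme (η₀ k))) (hK η hη) hcov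

end OfBiKummerData

/-! ### At the GENUINE connected data `ofConnectedTemperoidData` over `B^temp(Π^tp_X)⁰`: `hσ`, `hfrac` discharged as well -/

section OfConnectedTemperoidData

open Literature.AnabelianGeometry.SemiGraphs Literature.AlgebraicGeometry.Frobenioids.QuasiTemperoid.BTempConnected

universe u₀ v₀

variable {K : Type u₀} [Field K] {X : SemiGraphs.TemperedArithmeticGroup.{u₀} K} {D₀ : Type u₀} [Category.{v₀} D₀]
  {V : FrdIMonoidStub.{w}} {T₀ : RealifiedDivisorMonoids (D₀ := D₀) V}
  {VD : FrdICatStub.{u₀ + 1, u₀, w} (ConnectedPart (BTemp X.Pi))}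
  {tf : TemperedFrobenioid T₀ (ConnectedPart (BTemp X.Pi)) VD} {hZ : tf.monoidType = MonoidType.Z}
  {hP : ∀ A : (ConnectedPart (BTemp X.Pi))ᵒᵖ, IsPerfect (tf.Φ.carrier A)}
  {NH : Subgroup (Field.absoluteGaloisGroup K) → tf.category → ℕ+ → Prop} {A₀ : tf.category}
  {hA₀ : PreFrobenioid.IsFrobeniusTrivial tf.toElem A₀} {hA₀' : SemiGraphs.IsGaloisObj A₀.base.obj}
  {pullFrac : ∀ {A A' : (BiKummerSetting.mkOfConnectedTemperoid X tf hZ hP NH A₀ hA₀ hA₀').C} (_ : A' ⟶ A),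
    (BiKummerSetting.mkOfConnectedTemperoid X tf hZ hP NH A₀ hA₀ hA₀').biratUnits A →
      (BiKummerSetting.mkOfConnectedTemperoid X tf hZ hP NH A₀ hA₀ hA₀').biratUnits A'}
  {lv N : ℕ+} {l' : ℕ} {RD : RigidData.{max u₀ w} N l'}
  {θ : (BiKummerSetting.mkOfConnectedTemperoid X tf hZ hP NH A₀ hA₀ hA₀').biratUnits
    (BiKummerSetting.mkOfConnectedTemperoid X tf hZ hP NH A₀ hA₀ hA₀').Aodot}
  {Bl : (BiKummerSetting.mkOfConnectedTemperoid X tf hZ hP NH A₀ hA₀ hA₀').C}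
  {Pl : (BiKummerSetting.mkOfConnectedTemperoid X tf hZ hP NH A₀ hA₀ hA₀').FractionPair θ Bl}
  {Rl : (BiKummerSetting.mkOfConnectedTemperoid X tf hZ hP NH A₀ hA₀ hA₀').NthRoot θ Pl lv pullFrac}
  (h : ModelFrobenioid.Hypotheses tf.divisorMonoid tf.ratFnFunctor)
  (Q : FrobenioidTheta.ThetaSubquotientStub.{w} (ConnectedPart (BTemp X.Pi))) (odd_l : Odd (lv : ℕ))
  (R : (BiKummerSetting.mkOfConnectedTemperoid X tf hZ hP NH A₀ hA₀ hA₀').NthRoot Rl.root Rl.pair N pullFrac)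
  (ιX : RD.PiX ≃ₜ* X.Pi) (K' : Type w) [Field K'] (constEmb : K'ˣ →* tf.biratUnitsModel R.BN)
  (constEmb_injective : Function.Injective constEmb)
  (hinvc : ∀ g : Aut R.AN.base,
    pull tf.divisorMonoid g.hom (ModelFrobenioid.div R.pair.num) = ModelFrobenioid.div R.pair.num)
  (hinvp : ∀ y : RD.PiX, y ∈ RD.PiYdd →
    pull tf.divisorMonoid ((BiKummerSetting.mkOfConnectedTemperoid X tf hZ hP NH A₀ hA₀ hA₀').galoisSurj R.AN.base
      R.αData.isGalois (ιX y)).hom (ModelFrobenioid.div R.pair.den) = ModelFrobenioid.div R.pair.den)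

/-- **G-L6t23-3 (`hKR`) at the GENUINE connected data `ofConnectedTemperoidData`** (abc-iut-L2-t4, `A_⊙`, roots, constants over
`D := B^temp(Π^tp_X)⁰`, dictionary `toB = id`, `σ = s^trv_N` constructed): `hKR_ofBiKummerData_of_pin` with `hσ := baseMap_strvOfBiKummerData`
and `hfrac := coe_fracOfModel_mul_unit` DISCHARGED ([FrdI] Prop. 5.6 section / Thm. 5.2 (ii) dictionary — theorems of the model).  Residual
inputs: the pin `{hη₀, hdies, e, hme, hK}`, `H : Facts`, the cyclotome dictionary `m` with `CyclotomicCharacterCompatX`, the coverage `hcov`.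
[cite: MochizukiEtTh2009, Prop 5.5 proof p.327–328 (PDF pp.101–102); §5 p.330–331 (PDF pp.104–105)] -/
theorem hKR_ofConnectedTemperoidData_of_pin
    (P : FrobenioidCyclotomicRigidity.ThetaSubquotientProj
      (ofConnectedTemperoidData h Q odd_l R ιX K' constEmb constEmb_injective hinvc hinvp))
    (H : (ofConnectedTemperoidData h Q odd_l R ιX K' constEmb constEmb_injective hinvc hinvp).Facts)
    (m : (ofConnectedTemperoidData h Q odd_l R ιX K' constEmb constEmb_injective hinvc hinvp).muTorsion
        (ofConnectedTemperoidData h Q odd_l R ιX K' constEmb constEmb_injective hinvc hinvp).BN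
        (ofConnectedTemperoidData h Q odd_l R ιX K' constEmb constEmb_injective hinvc hinvp).N ≃* RD.mu)
    (hχX : (ofConnectedTemperoidData h Q odd_l R ιX K' constEmb constEmb_injective hinvc hinvp).CyclotomicCharacterCompatX
      RD.toThetaEnvData (MulEquiv.refl _) m)
    {η₀ : RD.PiYdd → RD.mu} (hη₀ : η₀ ∈ RD.thetaCocycles)
    (hdies : ∀ k : RD.PiYdd, rhoOfBiKummerData R ιX k = 1 → η₀ k = 1)
    (e : RD.mu → (ofConnectedTemperoidData h Q odd_l R ιX K' constEmb constEmb_injective hinvc hinvp).lDeltaModN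
      (ofConnectedTemperoidData h Q odd_l R ιX K' constEmb constEmb_injective hinvc hinvp).BN)
    (ν : (ofConnectedTemperoidData h Q odd_l R ιX K' constEmb constEmb_injective hinvc hinvp).lDeltaModN
        (ofConnectedTemperoidData h Q odd_l R ιX K' constEmb constEmb_injective hinvc hinvp).BN ≃*
      (ofConnectedTemperoidData h Q odd_l R ιX K' constEmb constEmb_injective hinvc hinvp).muTorsion
        (ofConnectedTemperoidData h Q odd_l R ιX K' constEmb constEmb_injective hinvc hinvp).BN
        (ofConnectedTemperoidData h Q odd_l R ιX K' constEmb constEmb_injective hinvc hinvp).N)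
    (hme : ∀ x : RD.mu, m (ν (e x)) = x)
    (hK : ∀ η : (ofConnectedTemperoidData h Q odd_l R ιX K' constEmb constEmb_injective hinvc hinvp).HB →
        (ofConnectedTemperoidData h Q odd_l R ιX K' constEmb constEmb_injective hinvc hinvp).lDeltaModN
          (ofConnectedTemperoidData h Q odd_l R ιX K' constEmb constEmb_injective hinvc hinvp).BN,
      (∀ k : RD.PiYdd, η ⟨rhoOfBiKummerData R ιX k, Subgroup.mem_map_of_mem _ k.2⟩ = e (η₀ k)) →
        FrobenioidThetaBiKummer.ThetaPairKummerClass
          (ofConnectedTemperoidData h Q odd_l R ιX K' constEmb constEmb_injective hinvc hinvp) η ν)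
    (hcov : ∀ k : (ofConnectedTemperoidData h Q odd_l R ιX K' constEmb constEmb_injective hinvc hinvp).HB,
      (k : Aut ((ofConnectedTemperoidData h Q odd_l R ιX K' constEmb constEmb_injective hinvc hinvp).base.obj
        (ofConnectedTemperoidData h Q odd_l R ιX K' constEmb constEmb_injective hinvc hinvp).BN)) ∈ P.pre _ →
      ∃ (y : RD.PiX) (_ : y ∈ RD.PiYdd),
        (ofConnectedTemperoidData h Q odd_l R ιX K' constEmb constEmb_injective hinvc hinvp).ρ y = k ∧
          y ∈ RD.lDeltaTheta) :
    ∀ (y₀ y : RD.PiX), y ∈ RD.PiYdd → rhoOfBiKummerData R ιX y ∈ P.pre R.BN.base →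
      pull tf.ratFnFunctor ((BiKummerSetting.mkOfConnectedTemperoid X tf hZ hP NH A₀ hA₀ hA₀').galoisSurj R.AN.base
            R.αData.isGalois (ιX y)).hom
          (pull tf.ratFnFunctor ((BiKummerSetting.mkOfConnectedTemperoid X tf hZ hP NH A₀ hA₀ hA₀').galoisSurj R.AN.base
              R.αData.isGalois (ιX y₀)).hom
            (MonoidHom.id (tf.biratUnitsModel R.AN) R.root : tf.ratFnFunctor.obj (op R.AN.base))) *
          (MonoidHom.id (tf.biratUnitsModel R.AN) R.root : tf.ratFnFunctor.obj (op R.AN.base)) =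
        pull tf.ratFnFunctor ((BiKummerSetting.mkOfConnectedTemperoid X tf hZ hP NH A₀ hA₀ hA₀').galoisSurj R.AN.base
              R.αData.isGalois (ιX y)).hom
            (MonoidHom.id (tf.biratUnitsModel R.AN) R.root : tf.ratFnFunctor.obj (op R.AN.base)) *
          pull tf.ratFnFunctor ((BiKummerSetting.mkOfConnectedTemperoid X tf hZ hP NH A₀ hA₀ hA₀').galoisSurj R.AN.base
              R.αData.isGalois (ιX y₀)).hom
            (MonoidHom.id (tf.biratUnitsModel R.AN) R.root : tf.ratFnFunctor.obj (op R.AN.base)) := by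
  delta ThetaFrobenioid.ofConnectedTemperoidData at P H m hχX e ν hK hcov
  exact hKR_ofBiKummerData_of_pin (S := BiKummerSetting.mkOfConnectedTemperoid X tf hZ hP NH A₀ hA₀ hA₀')
    (pullFrac := pullFrac) (RD := RD) (θ := θ) (Bl := Bl) (Pl := Pl) (Rl := Rl) h (fun _ => MonoidHom.id _) Q odd_l R ιX
    (BiKummerSetting.mkOfConnectedTemperoid_isOpen_ker_galoisSurj X tf hZ hP NH A₀ hA₀ hA₀' R.AN.base R.αData.isGalois)
    (strvOfBiKummerData h R) K' constEmb constEmb_injective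
    (hdivc_of_pull_invariant h.isDivisorial R (strvOfBiKummerData h R) (baseMap_strvOfBiKummerData h R) hinvc)
    (hdivp_of_pull_invariant h.isDivisorial R ιX (strvOfBiKummerData h R) (baseMap_strvOfBiKummerData h R) hinvp)
    (baseMap_strvOfBiKummerData h R) (fun s' s'' _ _ _ => BiKummerSetting.coe_fracOfModel_mul_unit tf T₀.isUnit_BΛ s' s'')
    P H m hχX hη₀ hdies e ν hme hK hcov

end OfConnectedTemperoidData

end ThetaFrobenioid

end Literature.AnabelianGeometry.EtaleTheta

end
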